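import Summits.RiemannHypothesis.RiemannHypothesis.Theorems.SignConeConeMagnificationCombTypeWeights
import Literature.NumberTheory.LFunctions.WeilCombTwoPointSummable
import Literature.NumberTheory.LFunctions.WeilCombAutocorrelationBump

/-!
# Crux `SignCone.ConeMagnification` (stmt-RiemannHypothesis-16303), line `Sketch` r9, stub `stub_combType` — assembly, part 4:
# the norm node `V_M(ℓ,ℓ',1) = B(0)·(gcd(ℓ',ℓ)/√(ℓℓ'))·log M + O(√(log M))`

The last hypothesis of both assembly interfaces (`CombType.typeBound_of_nodeData`, `CombType.typeBound_of_pairData`) is the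
two-sided evaluation of the NORM node `n = 1` of the pair `(ℓ, ℓ')` of the `ζ`-mollified comb with window `√(log M)/M`:
`|V_M(ℓ,ℓ',1) − (∫ b²)·(gcd(ℓ',ℓ)/√(ℓℓ'))·log M| ≤ C_n √(log M)` for `M ≥ 4096 L²`.  It follows from the lead's
`Literature.NumberTheory.LFunctions.node_weight_pair` at `n = 1` (error `C₃ + 8N₀Lh`), the deep-zone class identity
`Σ_{k' ≤ K}[ℓ ∣ ℓ'k']/k' = (gcd/ℓ)·H(⌊K/(ℓ/gcd)⌋)` (`CombType.sum_dvd_indicator_div_eq`), `log Y ≤ H(⌊Y⌋) ≤ 1 + log⌊Y⌋`, and the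
trivial bound `0 ≤ smooth term ≤ 8N₀L·hM = 8N₀L√(log M)`.

* `CombType.norm_node_eval` — the statement above, `C_n = N₀(2 + 4L²) + 16N₀L + C₃`.
-/

noncomputable section

-- `Summit.RiemannHypothesis.RiemannHypothesis.…` repeats a namespace component by design (D-0017 layout).
set_option linter.dupNamespace false

open scoped BigOperators Topology ContDiff
open MeasureTheory Set Filter

namespace Summit.RiemannHypothesis.RiemannHypothesis.Theorems.SignConeConeMagnification

open Literature.NumberTheory.LFunctions

namespace CombType

/-- `gcd(ℓ',ℓ)/√(ℓℓ') ≤ 1` for `ℓ, ℓ' ≥ 1`. [folklore] -/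
theorem gcd_div_sqrt_le_one {ℓ ℓ' : ℕ} (hℓ : 1 ≤ ℓ) (hℓ' : 1 ≤ ℓ') :
    (Nat.gcd ℓ' ℓ : ℝ) / Real.sqrt ((ℓ : ℝ) * ℓ') ≤ 1 := by
  have hg1 : (Nat.gcd ℓ' ℓ : ℝ) ≤ ℓ := by exact_mod_cast Nat.le_of_dvd (by omega) (Nat.gcd_dvd_right ℓ' ℓ)
  have hg2 : (Nat.gcd ℓ' ℓ : ℝ) ≤ ℓ' := by exact_mod_cast Nat.le_of_dvd (by omega) (Nat.gcd_dvd_left ℓ' ℓ)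
  have hg0 : (0 : ℝ) ≤ Nat.gcd ℓ' ℓ := Nat.cast_nonneg _
  have hsq : (Nat.gcd ℓ' ℓ : ℝ) ≤ Real.sqrt ((ℓ : ℝ) * ℓ') := by
    rw [show (Nat.gcd ℓ' ℓ : ℝ) = Real.sqrt ((Nat.gcd ℓ' ℓ : ℝ) ^ 2) from (Real.sqrt_sq hg0).symm]
    refine Real.sqrt_le_sqrt ?_
    calc (Nat.gcd ℓ' ℓ : ℝ) ^ 2 = (Nat.gcd ℓ' ℓ : ℝ) * Nat.gcd ℓ' ℓ := by ring
      _ ≤ ℓ * ℓ' := mul_le_mul hg1 hg2 hg0 (by positivity)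
  have hpos : 0 < Real.sqrt ((ℓ : ℝ) * ℓ') := Real.sqrt_pos.2 (by positivity)
  rwa [div_le_one hpos]

/-- `(√ℓ/√ℓ')·(1/(ℓ/g)) = g/√(ℓℓ')` for `g ∣ ℓ`, `ℓ, ℓ' ≥ 1`, `g ≥ 1`. [folklore] -/
theorem sqrt_div_mul_inv_quot {ℓ ℓ' g : ℕ} (hℓ : 1 ≤ ℓ) (hℓ' : 1 ≤ ℓ') (hg : g ∣ ℓ) (hg1 : 1 ≤ g) :
    Real.sqrt ℓ / Real.sqrt ℓ' * (1 / ((ℓ / g : ℕ) : ℝ)) = (g : ℝ) / Real.sqrt ((ℓ : ℝ) * ℓ') := by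
  have hℓ0 : (0 : ℝ) < ℓ := by exact_mod_cast hℓ
  have hℓ'0 : (0 : ℝ) < ℓ' := by exact_mod_cast hℓ'
  have hg0 : (0 : ℝ) < g := by exact_mod_cast hg1
  rw [Nat.cast_div hg hg0.ne', Real.sqrt_mul hℓ0.le]
  have hs : Real.sqrt (ℓ : ℝ) * Real.sqrt ℓ = ℓ := Real.mul_self_sqrt hℓ0.le
  have hsℓ : 0 < Real.sqrt (ℓ : ℝ) := Real.sqrt_pos.2 hℓ0
  have hsℓ' : 0 < Real.sqrt (ℓ' : ℝ) := Real.sqrt_pos.2 hℓ'0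
  field_simp
  nlinarith [hs]

/-- `|H(⌊Y⌋) − log M| ≤ 1 + log(M/Y)` for `0 < Y ≤ M`: `log Y ≤ H(⌊Y⌋) ≤ 1 + log ⌊Y⌋ ≤ 1 + log M`. [folklore] -/
theorem abs_harmonic_floor_sub_log_le {Y Mr : ℝ} (hY : 0 < Y) (hYM : Y ≤ Mr) (hMr : 1 ≤ Mr) :
    |(∑ j ∈ Finset.Icc 1 ⌊Y⌋₊, (1 : ℝ) / j) - Real.log Mr| ≤ 1 + Real.log (Mr / Y) := by
  have hM : 0 < Mr := lt_of_lt_of_le hY hYM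
  have hlow : Real.log Y ≤ ∑ j ∈ Finset.Icc 1 ⌊Y⌋₊, (1 : ℝ) / j := log_le_sum_inv_Icc_floor hY.le
  have hup : ∑ j ∈ Finset.Icc 1 ⌊Y⌋₊, (1 : ℝ) / j ≤ 1 + Real.log Mr := by
    refine (LevinsonSums.sum_Icc_one_div_le _).trans ?_
    rcases Nat.eq_zero_or_pos ⌊Y⌋₊ with hz | hpos
    · rw [hz]; simp only [Nat.cast_zero, Real.log_zero, add_zero]
      linarith [Real.log_nonneg hMr]
    · have : Real.log (⌊Y⌋₊ : ℕ) ≤ Real.log Mr :=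
        Real.log_le_log (by exact_mod_cast hpos) ((Nat.floor_le hY.le).trans hYM)
      linarith
  have hdiv : Real.log (Mr / Y) = Real.log Mr - Real.log Y := Real.log_div hM.ne' hY.ne'
  have hdiv0 : 0 ≤ Real.log (Mr / Y) := Real.log_nonneg (by rw [le_div_iff₀ hY]; linarith)
  rw [abs_le]
  constructor <;> linarith

/-- The bookkeeping of `norm_node_eval_window`. [folklore] -/
theorem norm_node_algebra {V D S c H lg E X S₈ c₁ N : ℝ}
    (e1 : |V - c * D - S| ≤ E) (hD : c * D = c₁ * H) (e2 : |H - lg| ≤ X)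
    (hS0 : 0 ≤ S) (hS : S ≤ S₈) (hc0 : 0 ≤ c₁) (hc1 : c₁ ≤ N) :
    |V - c₁ * lg| ≤ E + S₈ + N * X := by
  rw [hD] at e1
  have e3 : |c₁ * H - c₁ * lg| ≤ N * X := by
    rw [← mul_sub, abs_mul, abs_of_nonneg hc0]
    exact mul_le_mul hc1 e2 (abs_nonneg _) (hc0.trans hc1)
  obtain ⟨l1, u1⟩ := abs_le.1 e1
  obtain ⟨l3, u3⟩ := abs_le.1 e3
  rw [abs_le]
  constructor <;> linarith

/-- **The norm node, general window.**  Under the hypotheses of `node_weight_pair` (a `C²` bump autocorrelation `B ≥ 0`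
supported in `[-2,2]`, `1 ≤ ℓ, ℓ' ≤ L`, `0 < h ≤ 1/(32L)`, `hM ≥ 1`, `h²M ≤ 1`):
`|V(1) − B(0)·(gcd(ℓ',ℓ)/√(ℓℓ'))·log M| ≤ C₃ + 8N₀Lh + 8N₀L·hM + N₀(1 + log(4hM·ℓ'·(ℓ/gcd)))`. [folklore] -/
theorem norm_node_eval_window {B B' B'' : ℝ → ℝ} {N₀ N₁ N₂ h : ℝ} {L ℓ ℓ' M : ℕ}
    (hB : ∀ x, HasDerivAt B (B' x) x) (hB' : ∀ x, HasDerivAt B' (B'' x) x)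
    (h0 : ∀ x, |B x| ≤ N₀) (h1 : ∀ x, |B' x| ≤ N₁) (h2 : ∀ x, |B'' x| ≤ N₂)
    (hBs : ∀ x, 2 < |x| → B x = 0) (hB0 : ∀ x, 0 ≤ B x)
    (hL : 1 ≤ L) (hℓ1 : 1 ≤ ℓ) (hℓL : ℓ ≤ L) (hℓ'1 : 1 ≤ ℓ') (hℓ'L : ℓ' ≤ L)
    (hh0 : 0 < h) (hhL : h ≤ 1 / (32 * L)) (hhM1 : 1 ≤ h * M) (hhM2 : h ^ 2 * M ≤ 1) :
    |(∑ k' ∈ Finset.Icc 1 M,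
        (∑ k ∈ Finset.Icc 1 M, B ((Real.log ((ℓ' : ℝ) * k' / ℓ) - Real.log k) / h) / Real.sqrt k) / Real.sqrt k') -
        B 0 * ((Nat.gcd ℓ' ℓ : ℝ) / Real.sqrt ((ℓ : ℝ) * ℓ')) * Real.log M| ≤
      (8 * ((N₀ + 2 * N₁ + N₂) * (96 + 192 * L) * L ^ 2) * L + 64 * N₀ * L ^ 2) + 8 * N₀ * L * h +
        8 * N₀ * L * (h * M) + N₀ * (1 + Real.log (4 * h * M * ℓ' * (ℓ / Nat.gcd ℓ' ℓ : ℕ))) := by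
  have hN₀ : 0 ≤ N₀ := (abs_nonneg _).trans (h0 0)
  have hLR : (1 : ℝ) ≤ L := by exact_mod_cast hL
  have hℓR : (1 : ℝ) ≤ ℓ := by exact_mod_cast hℓ1
  have hℓ'R : (1 : ℝ) ≤ ℓ' := by exact_mod_cast hℓ'1
  have hℓLR : (ℓ : ℝ) ≤ L := by exact_mod_cast hℓL
  have hℓ'LR : (ℓ' : ℝ) ≤ L := by exact_mod_cast hℓ'L
  have hMpos : 0 < M := by
    rcases Nat.eq_zero_or_pos M with hM0 | hM0
    · rw [hM0, Nat.cast_zero, mul_zero] at hhM1; exact absurd hhM1 (by norm_num)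
    · exact hM0
  have hMR : (1 : ℝ) ≤ M := by exact_mod_cast hMpos
  -- the node lemma at `n = 1`
  have hnode := node_weight_pair (n := 1) hB hB' h0 h1 h2 hBs hB0 hL hℓ1 hℓL hℓ'1 hℓ'L le_rfl hh0 hhL hhM1 hhM2
  simp only [Nat.cast_one, one_mul, mul_one, Real.sqrt_one, div_one] at hnode
  -- (1) the deep term: `Σ [ℓ ∣ ℓ'k']/k' = (1/q) H(K/q)`, `q = ℓ/g`, and `(√ℓ/√ℓ')/q = g/√(ℓℓ')`
  have hℓ0 : ℓ ≠ 0 := by omega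
  have hg1 : 1 ≤ Nat.gcd ℓ' ℓ := Nat.gcd_pos_of_pos_right _ (by omega)
  have hgdvd : Nat.gcd ℓ' ℓ ∣ ℓ := Nat.gcd_dvd_right ℓ' ℓ
  have hq1 : 1 ≤ ℓ / Nat.gcd ℓ' ℓ := Nat.div_pos (Nat.le_of_dvd (by omega) hgdvd) hg1
  have hqR : (1 : ℝ) ≤ ((ℓ / Nat.gcd ℓ' ℓ : ℕ) : ℝ) := by exact_mod_cast hq1
  have hDq : B 0 * (Real.sqrt ℓ / Real.sqrt ℓ') *
      (∑ k' ∈ Finset.Icc 1 ⌊1 / (4 * h) / (ℓ' : ℝ)⌋₊, (if ℓ ∣ ℓ' * k' then 1 / (k' : ℝ) else 0)) =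
      B 0 * ((Nat.gcd ℓ' ℓ : ℝ) / Real.sqrt ((ℓ : ℝ) * ℓ')) *
        ∑ j ∈ Finset.Icc 1 (⌊1 / (4 * h) / (ℓ' : ℝ)⌋₊ / (ℓ / Nat.gcd ℓ' ℓ)), (1 : ℝ) / j := by
    have := sum_dvd_indicator_div_eq ℓ 1 ℓ' ⌊1 / (4 * h) / (ℓ' : ℝ)⌋₊ hℓ0
    simp only [one_mul] at this
    rw [this, sum_one_div_mul_eq, ← mul_assoc, mul_assoc (B 0), sqrt_div_mul_inv_quot hℓ1 hℓ'1 hgdvd hg1]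
  -- (2) the harmonic sum against `log M`
  have hKq : ⌊1 / (4 * h) / (ℓ' : ℝ)⌋₊ / (ℓ / Nat.gcd ℓ' ℓ) =
      ⌊1 / (4 * h) / (ℓ' : ℝ) / ((ℓ / Nat.gcd ℓ' ℓ : ℕ) : ℝ)⌋₊ := (Nat.floor_div_natCast _ _).symm
  have hY0 : 0 < 1 / (4 * h) / (ℓ' : ℝ) / ((ℓ / Nat.gcd ℓ' ℓ : ℕ) : ℝ) := by positivity
  have h4M : 1 / (4 * h) ≤ M := by
    rw [div_le_iff₀ (by positivity)]; nlinarith only [hhM1, hMR, hh0]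
  have hYM : 1 / (4 * h) / (ℓ' : ℝ) / ((ℓ / Nat.gcd ℓ' ℓ : ℕ) : ℝ) ≤ M :=
    calc 1 / (4 * h) / ℓ' / ((ℓ / Nat.gcd ℓ' ℓ : ℕ) : ℝ) ≤ 1 / (4 * h) / ℓ' := div_le_self (by positivity) hqR
      _ ≤ 1 / (4 * h) := div_le_self (by positivity) hℓ'R
      _ ≤ M := h4M
  have hH := abs_harmonic_floor_sub_log_le hY0 hYM hMR
  rw [← hKq] at hH
  have hMYeq : (M : ℝ) / (1 / (4 * h) / (ℓ' : ℝ) / ((ℓ / Nat.gcd ℓ' ℓ : ℕ) : ℝ)) =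
      4 * h * M * ℓ' * ((ℓ / Nat.gcd ℓ' ℓ : ℕ) : ℝ) := by
    field_simp
  rw [hMYeq] at hH
  have hgc : (Nat.gcd ℓ' ℓ : ℝ) / Real.sqrt ((ℓ : ℝ) * ℓ') ≤ 1 := gcd_div_sqrt_le_one hℓ1 hℓ'1
  have hgc0 : 0 ≤ (Nat.gcd ℓ' ℓ : ℝ) / Real.sqrt ((ℓ : ℝ) * ℓ') := by positivity
  have hB00 : 0 ≤ B 0 := hB0 0
  have hB0N : B 0 ≤ N₀ := (le_abs_self _).trans (h0 0)
  have hc0 : 0 ≤ B 0 * ((Nat.gcd ℓ' ℓ : ℝ) / Real.sqrt ((ℓ : ℝ) * ℓ')) := mul_nonneg hB00 hgc0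
  have hc1 : B 0 * ((Nat.gcd ℓ' ℓ : ℝ) / Real.sqrt ((ℓ : ℝ) * ℓ')) ≤ N₀ := by
    calc B 0 * ((Nat.gcd ℓ' ℓ : ℝ) / Real.sqrt ((ℓ : ℝ) * ℓ')) ≤ N₀ * 1 := mul_le_mul hB0N hgc hgc0 hN₀
      _ = N₀ := mul_one _
  -- (3) the smooth term: `0 ≤ hβ(√ℓ'/√ℓ)Nn ≤ 8N₀L·hM`
  have hβ0 : 0 ≤ ∫ v, B v * Real.exp (-(h * v) / 2) := toothBeta_nonneg hB0 h
  have h32 : 1 / (32 * (L : ℝ)) ≤ 1 / 32 := one_div_le_one_div_of_le (by norm_num) (by linarith)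
  have hh4 : h ≤ 1 / 4 := by linarith
  have hβ8 : (∫ v, B v * Real.exp (-(h * v) / 2)) ≤ 8 * N₀ := toothBeta_le hB0 h0 hBs hh0.le hh4
  have hratio : Real.sqrt ℓ' / Real.sqrt ℓ ≤ L := by
    have h1' : Real.sqrt (ℓ' : ℝ) ≤ L := by
      rw [Real.sqrt_le_left (by linarith)]
      calc (ℓ' : ℝ) ≤ L := hℓ'LR
        _ = L * 1 := (mul_one _).symm
        _ ≤ L * L := mul_le_mul_of_nonneg_left hLR (by linarith)
        _ = L ^ 2 := (sq _).symm
    have h2' : 1 ≤ Real.sqrt (ℓ : ℝ) := by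
      rw [Real.le_sqrt' one_pos, one_pow]; exact hℓR
    calc Real.sqrt ℓ' / Real.sqrt ℓ ≤ Real.sqrt ℓ' / 1 :=
          div_le_div_of_nonneg_left (Real.sqrt_nonneg _) one_pos h2'
      _ ≤ L := by rw [div_one]; exact h1'
  have hNn0 : (0 : ℝ) ≤ ((min M ⌊(ℓ : ℝ) * M * Real.exp (-(2 * h)) / (ℓ' : ℝ)⌋₊ - ⌊1 / (4 * h) / (ℓ' : ℝ)⌋₊ : ℕ) : ℝ) :=
    Nat.cast_nonneg _
  have hNnM : (((min M ⌊(ℓ : ℝ) * M * Real.exp (-(2 * h)) / (ℓ' : ℝ)⌋₊ - ⌊1 / (4 * h) / (ℓ' : ℝ)⌋₊ : ℕ) : ℝ)) ≤ M := by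
    have : (min M ⌊(ℓ : ℝ) * M * Real.exp (-(2 * h)) / (ℓ' : ℝ)⌋₊ - ⌊1 / (4 * h) / (ℓ' : ℝ)⌋₊ : ℕ) ≤ M :=
      le_trans (Nat.sub_le _ _) (min_le_left _ _)
    exact_mod_cast this
  have hsm0 : 0 ≤ h * (∫ v, B v * Real.exp (-(h * v) / 2)) * (Real.sqrt ℓ' / Real.sqrt ℓ) *
      (((min M ⌊(ℓ : ℝ) * M * Real.exp (-(2 * h)) / (ℓ' : ℝ)⌋₊ - ⌊1 / (4 * h) / (ℓ' : ℝ)⌋₊ : ℕ) : ℝ)) := by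
    positivity
  have hsm : h * (∫ v, B v * Real.exp (-(h * v) / 2)) * (Real.sqrt ℓ' / Real.sqrt ℓ) *
      (((min M ⌊(ℓ : ℝ) * M * Real.exp (-(2 * h)) / (ℓ' : ℝ)⌋₊ - ⌊1 / (4 * h) / (ℓ' : ℝ)⌋₊ : ℕ) : ℝ)) ≤
      8 * N₀ * L * (h * M) := by
    calc h * (∫ v, B v * Real.exp (-(h * v) / 2)) * (Real.sqrt ℓ' / Real.sqrt ℓ) *
        (((min M ⌊(ℓ : ℝ) * M * Real.exp (-(2 * h)) / (ℓ' : ℝ)⌋₊ - ⌊1 / (4 * h) / (ℓ' : ℝ)⌋₊ : ℕ) : ℝ))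
        ≤ h * (8 * N₀) * L * M := by
          refine mul_le_mul (mul_le_mul (mul_le_mul_of_nonneg_left hβ8 hh0.le) hratio (by positivity)
            (by positivity)) hNnM hNn0 (by positivity)
      _ = 8 * N₀ * L * (h * M) := by ring
  -- (4) assemble
  have key := norm_node_algebra hnode hDq hH hsm0 hsm hc0 hc1
  refine key.trans (le_of_eq ?_)
  ring

set_option maxHeartbeats 400000 in
/-- **The norm node.**  For a smooth real bump `b ≥ 0` supported in `[-1,1]` and `L ≥ 1` there is `C_n` with
`|V_M(ℓ,ℓ',1) − (∫ b²)·(gcd(ℓ',ℓ)/√(ℓℓ'))·log M| ≤ C_n √(log M)` for all `M ≥ 4096L²` and `1 ≤ ℓ, ℓ' ≤ L`, where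
`V_M(ℓ,ℓ',1) = Σ_{k' ≤ M} Σ_{k ≤ M} B((log(ℓ'k'/ℓ) − log k)/h)/√(kk')`, `B(v) = ∫ b(u)b(u−v)du`, `h = √(log M)/M`. [folklore] -/
theorem norm_node_eval {b : ℝ → ℝ} (hb : ContDiff ℝ ∞ b) (hbc : HasCompactSupport b)
    (hbs : tsupport b ⊆ Icc (-1) 1) (hb0 : ∀ x, 0 ≤ b x) {L : ℕ} (hL : 1 ≤ L) :
    ∃ Cn : ℝ, ∀ M : ℕ, 4096 * L ^ 2 ≤ M → ∀ ℓ ∈ Finset.Icc 1 L, ∀ ℓ' ∈ Finset.Icc 1 L,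
      |(∑ k' ∈ Finset.Icc 1 M, (∑ k ∈ Finset.Icc 1 M,
          (∫ u, b u * b (u - (Real.log (((1 : ℕ) : ℝ) * ℓ' * k' / ℓ) - Real.log k) / (Real.sqrt (Real.log M) / M))) /
            Real.sqrt k) / Real.sqrt k' / Real.sqrt ((1 : ℕ) : ℝ)) -
        (∫ x, b x ^ 2) * ((Nat.gcd ℓ' ℓ : ℝ) / Real.sqrt ((ℓ : ℝ) * ℓ')) * Real.log M| ≤
      Cn * Real.sqrt (Real.log M) := by
  obtain ⟨N₀, N₁, N₂, hB, hB', h0, h1, h2, hBs, hB0⟩ := autocorr_package hb hbc hbs hb0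
  have hN₀ : 0 ≤ N₀ := (abs_nonneg _).trans (h0 0)
  have hN₁ : 0 ≤ N₁ := (abs_nonneg _).trans (h1 0)
  have hN₂ : 0 ≤ N₂ := (abs_nonneg _).trans (h2 0)
  set C₃ : ℝ := 8 * ((N₀ + 2 * N₁ + N₂) * (96 + 192 * L) * L ^ 2) * L + 64 * N₀ * L ^ 2 with hC₃
  have hLR : (1 : ℝ) ≤ L := by exact_mod_cast hL
  have hC₃0 : 0 ≤ C₃ := by positivity
  refine ⟨N₀ * (2 + 4 * L ^ 2) + 16 * N₀ * L + C₃, fun M hM ℓ hℓ ℓ' hℓ' => ?_⟩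
  obtain ⟨hℓ1, hℓL⟩ := Finset.mem_Icc.1 hℓ
  obtain ⟨hℓ'1, hℓ'L⟩ := Finset.mem_Icc.1 hℓ'
  obtain ⟨-, hκ1, -, hh0, hhL, hhM1, hhM2, -, -, -, -⟩ := comb_params_of_large hL hM
  set κ : ℝ := Real.sqrt (Real.log M) with hκ
  have hMpos : 0 < M := by
    have : 1 ≤ 4096 * L ^ 2 := by nlinarith
    omega
  have hMR : (0 : ℝ) < M := by exact_mod_cast hMpos
  have hhM : κ / M * M = κ := by field_simp
  have hℓ'LR : (ℓ' : ℝ) ≤ L := by exact_mod_cast hℓ'L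
  have hℓLR : (ℓ : ℝ) ≤ L := by exact_mod_cast hℓL
  have hw := norm_node_eval_window (M := M) hB hB' h0 h1 h2 hBs hB0 hL hℓ1 hℓL hℓ'1 hℓ'L hh0 hhL hhM1 hhM2
  rw [hhM] at hw
  -- the logarithm: `log(4κ ℓ' q) ≤ 4κL²`
  have hq : ((ℓ / Nat.gcd ℓ' ℓ : ℕ) : ℝ) ≤ L :=
    le_trans (by exact_mod_cast Nat.div_le_self _ _) hℓLR
  have hq1 : (1 : ℝ) ≤ ((ℓ / Nat.gcd ℓ' ℓ : ℕ) : ℝ) := by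
    have hg1 : 1 ≤ Nat.gcd ℓ' ℓ := Nat.gcd_pos_of_pos_right _ (by omega)
    exact_mod_cast Nat.div_pos (Nat.le_of_dvd (by omega) (Nat.gcd_dvd_right ℓ' ℓ)) hg1
  have hlogb : Real.log (4 * (κ / M) * M * ℓ' * (ℓ / Nat.gcd ℓ' ℓ : ℕ)) ≤ 4 * κ * L ^ 2 := by
    rw [mul_assoc (4 : ℝ) (κ / M) M, hhM]
    have hpos : 0 < 4 * κ * ℓ' * ((ℓ / Nat.gcd ℓ' ℓ : ℕ) : ℝ) := by positivity
    calc Real.log (4 * κ * ℓ' * ((ℓ / Nat.gcd ℓ' ℓ : ℕ) : ℝ)) ≤ 4 * κ * ℓ' * ((ℓ / Nat.gcd ℓ' ℓ : ℕ) : ℝ) :=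
          (Real.log_le_sub_one_of_pos hpos).trans (by linarith)
      _ ≤ 4 * κ * L ^ 2 := by
          have : (ℓ' : ℝ) * ((ℓ / Nat.gcd ℓ' ℓ : ℕ) : ℝ) ≤ L * L :=
            mul_le_mul hℓ'LR hq (by positivity) (by positivity)
          nlinarith
  have hB0int : (∫ u, b u * b (u - 0)) = ∫ x, b x ^ 2 := autocorr_zero b
  -- the statement's `V` is the window lemma's `V` (beta-reduction and `n = 1` casts)
  have hV1eq : (∑ k' ∈ Finset.Icc 1 M, (∑ k ∈ Finset.Icc 1 M,
      (∫ u, b u * b (u - (Real.log (((1 : ℕ) : ℝ) * ℓ' * k' / ℓ) - Real.log k) / (Real.sqrt (Real.log M) / M))) /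
        Real.sqrt k) / Real.sqrt k' / Real.sqrt ((1 : ℕ) : ℝ)) =
      ∑ k' ∈ Finset.Icc 1 M, (∑ k ∈ Finset.Icc 1 M,
        (∫ u, b u * b (u - (Real.log ((ℓ' : ℝ) * k' / ℓ) - Real.log k) / (κ / M))) / Real.sqrt k) / Real.sqrt k' := by
    simp only [hκ, Nat.cast_one, one_mul, Real.sqrt_one, div_one]
  rw [hV1eq, ← hB0int]
  refine hw.trans ?_
  have hh1 : κ / M ≤ 1 := by
    have : κ / M ≤ 1 / (32 * L) := hhL
    have h32 : 1 / (32 * (L : ℝ)) ≤ 1 := by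
      rw [div_le_one (by positivity)]; linarith
    linarith
  have hκL : N₀ * (1 + 4 * κ * L ^ 2) ≤ N₀ * (2 + 4 * L ^ 2) * κ := by
    have : 1 + 4 * κ * L ^ 2 ≤ (2 + 4 * L ^ 2) * κ := by nlinarith
    calc N₀ * (1 + 4 * κ * L ^ 2) ≤ N₀ * ((2 + 4 * L ^ 2) * κ) := mul_le_mul_of_nonneg_left this hN₀
      _ = _ := by ring
  have hC₃κ : C₃ + 8 * N₀ * L ≤ (C₃ + 8 * N₀ * L) * κ := by
    have := mul_le_mul_of_nonneg_left hκ1 (show 0 ≤ C₃ + 8 * N₀ * L by positivity)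
    linarith
  have hhN : 8 * N₀ * L * (κ / M) ≤ 8 * N₀ * L := by
    have := mul_le_mul_of_nonneg_left hh1 (show 0 ≤ 8 * N₀ * L by positivity)
    linarith
  have hlogN : N₀ * (1 + Real.log (4 * (κ / M) * M * ℓ' * (ℓ / Nat.gcd ℓ' ℓ : ℕ))) ≤ N₀ * (1 + 4 * κ * L ^ 2) :=
    mul_le_mul_of_nonneg_left (by linarith) hN₀
  nlinarith [hκL, hC₃κ, hhN, hlogN]

/-- **Anchor `combTypeNormNode`** (registered sub-goal; `norm_node_eval` with explicit quantifiers): the norm node of the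
`ζ`-mollified comb, `V_M(ℓ,ℓ',1) = (∫ b²)(gcd(ℓ',ℓ)/√(ℓℓ')) log M + O(√(log M))`. [folklore] -/
theorem combTypeNormNode : ∀ b : ℝ → ℝ, (ContDiff ℝ (⊤ : ℕ∞) b) → (HasCompactSupport b) → (tsupport b ⊆ Set.Icc (-1) 1) → (∀ x, 0 ≤ b x) → ∀ L : ℕ, (1 ≤ L) → ∃ Cn : ℝ, ∀ M : ℕ, 4096 * L ^ 2 ≤ M → ∀ ℓ ∈ Finset.Icc 1 L, ∀ ℓ' ∈ Finset.Icc 1 L, |(∑ k' ∈ Finset.Icc 1 M, (∑ k ∈ Finset.Icc 1 M, (∫ u, b u * b (u - (Real.log (((1 : ℕ) : ℝ) * ℓ' * k' / ℓ) - Real.log k) / (Real.sqrt (Real.log M) / M))) / Real.sqrt k) / Real.sqrt k' / Real.sqrt ((1 : ℕ) : ℝ)) - (∫ x, b x ^ 2) * ((Nat.gcd ℓ' ℓ : ℝ) / Real.sqrt ((ℓ : ℝ) * ℓ')) * Real.log M| ≤ Cn * Real.sqrt (Real.log M) :=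
  fun _ hb hbc hbs hb0 _ hL => norm_node_eval hb hbc hbs hb0 hL

end CombType

end Summit.RiemannHypothesis.RiemannHypothesis.Theorems.SignConeConeMagnification

end
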